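import Literature.NumberTheory.Weil1965.ThetaIntegralFibreMeasureSplitPlace
import Literature.NumberTheory.Weil1965.AdelicSiegelFibreMeasureSplitPlaceWeighted
import Literature.NumberTheory.Weil1965.ThetaIntegralGeometricActionHaar
import Literature.NumberTheory.Automorphic.AdicCompletionLocalField
import Summits.HodgeConjecture.HodgeConjecture.Theorems.H413E2SWSplitPlaceLetters
import HarnessLib

/-!
# H413 · E-2 · SW2 (iii) — I-CLOSE: the split-place FRAME and the two (T2a)-TRIPLES `H₁`, `H₂` AT THE CM DATUM

Cell `hodgecm-mathlib`, crux H413 (`stmt-HodgeConjecture-24833`), child line `Cruxes/H413/Lines/F0_E2SiegelWeilWeilRange.lean`,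
stub `stub_SW2iii_siegelWeil`, identity half; (T1) outer assembly `Theorems/H413E2SWIdentityClose` (B-p03 (g23), HOME v3) binders
`βv fr he1 he2 b' H₁ H₂` (:241–:276).  PROOF lane, `--supports stmt-HodgeConjecture-24833 --as helper`.  KERNEL MATHEMATICS ONLY
(no definition, no `sorry`).  HC_CM is proved only modulo the 7 printed citations until rung 0 closes; nothing here is about Hodge classes.

WHAT THIS FILE DOES.  For the rank-one unitary dual pair `(U(J_V), U(J_W ⊕ −J_W))` over the CM extension `E/F` and a finite place `v`
of `F` with `s² = d` in `F_v` (a split place), it PRODUCES — from A-p01's ★ letters `E2SWSplitPlaceLetters.exists_splitPlaceLetters`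
(frame `e = (β_v × id) ∘ placeSplitting⁻¹`, isometries `T g = A_{h_g}`) — ONE frame `βv`, `fr` with the clauses `he1`, `he2`, and for
every `b ≠ 0` the two triples
* `H₁ b` (theta side) := ★ `UnitaryDoubling.map_fibreMeasure_thetaOrbitFunctionalReal_identityClose_hypotheses` (A-p08 (g17)),
* `H₂ b` (Eisenstein side) := ★ `map_adelicSiegelFibreMeasure_identityClose_hypotheses` (A-p08 (g17)) with `hTμ` := ★
  `UnitaryDoubling.measurePreserving_vDiagAct` (A-p01 (g13)),
in the EXACT binder shapes of (T1) v3 `doubledThetaIntegral_eq_mul_eis_of_frame` (`K := F_v`, `κ := Fin n`, `Y := trivialAt`,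
`b' b := (b : F_v)`), for an arbitrary continuous `h` with `hhN : ∀ x, h x = hNorm … x` (the E-side letters' spelling of the norm).
The non-vanishing clauses `(fr x).1.1 ≠ 0 ∧ (fr x).1.2 ≠ 0` of `hfib` follow from `(fr x).1.1 ⬝ᵥ (fr x).1.2 = b ≠ 0`; at `b = 0`
(isotropic fibre) they are NOT consequences of the letters and are not claimed here.

References: A. Weil, *Sur la formule de Siegel dans la théorie des groupes classiques*, Acta Math. 113 (1965), Chap. IV n° 46
p. 66; Chap. V n° 50 pp. 73–74 [Weil1965].
-/

set_option autoImplicit false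
-- the cell's `Summit.HodgeConjecture.HodgeConjecture.…` namespace repeats the summit name by design (D-0017 layout)
set_option linter.dupNamespace false

noncomputable section

open MeasureTheory NumberField Filter Topology Set IsDedekindDomain
open scoped NNReal Matrix ENNReal RestrictedProduct
open Literature.NumberTheory.Automorphic Literature.NumberTheory.Weil1964 Literature.NumberTheory.Weil1965
open Literature.NumberTheory.Weil1965.UnitaryDoubling
open Literature.NumberTheory.GelbartRogawski1991 Literature.NumberTheory.GelbartRogawski1991.UnitaryDualPair
open Literature.RepresentationTheory.HeisenbergGroup
open Literature.NumberTheory.GaloisRepresentations.IsNonarchimedeanLocalField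
open Literature.NumberTheory.Automorphic.AdelicVector (evalAt trivialAt placeSplitting)
open Summit.HodgeConjecture.HodgeConjecture.Cruxes.H413.E2SWSplitPlaceLetters

namespace Summit.HodgeConjecture.HodgeConjecture.Cruxes.H413.E2SWIdentityCloseTriplesCM

/-- a linear equivalence from `K^m` onto `K^p × K^q` has a continuous inverse (all linear maps out of `K^p`, `K^q` are continuous).
[folklore] -/
private theorem continuous_linearEquiv_symm_prod {K : Type} [Field K] [TopologicalSpace K] [IsTopologicalRing K] {m p q : ℕ}
    (β : (Fin m → K) ≃ₗ[K] ((Fin p → K) × (Fin q → K))) : Continuous β.symm := by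
  haveI : ContinuousSMul K K := ⟨continuous_mul⟩
  have h1 : Continuous fun a : Fin p → K => β.symm.toLinearMap (LinearMap.inl K _ _ a) :=
    (β.symm.toLinearMap.comp (LinearMap.inl K _ _)).continuous_on_pi
  have h2 : Continuous fun b : Fin q → K => β.symm.toLinearMap (LinearMap.inr K _ _ b) :=
    (β.symm.toLinearMap.comp (LinearMap.inr K _ _)).continuous_on_pi
  have heq : (fun z : (Fin p → K) × (Fin q → K) => β.symm z) =
      fun z => β.symm.toLinearMap (LinearMap.inl K _ _ z.1) + β.symm.toLinearMap (LinearMap.inr K _ _ z.2) := by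
    funext z
    rw [← map_add, LinearMap.inl_apply, LinearMap.inr_apply, Prod.mk_add_mk, add_zero, zero_add]
    rfl
  have hc : Continuous fun z : (Fin p → K) × (Fin q → K) => β.symm z := by
    rw [heq]
    exact (h1.comp continuous_fst).add (h2.comp continuous_snd)
  exact hc

/-- `𝔸_F = F_∞ × 𝔸_F^∞` is Hausdorff (Mathlib instances on the two factors). [folklore] -/
private theorem t2Space_adeleRing' (K : Type*) [Field K] [NumberField K] : T2Space (AdeleRing (𝓞 K) K) := by
  haveI : T2Space (FiniteAdeleRing (𝓞 K) K) := inferInstanceAs <| T2Space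
    (Πʳ w : HeightOneSpectrum (𝓞 K), [w.adicCompletion K, w.adicCompletionIntegers K])
  haveI : T2Space (InfiniteAdeleRing K) :=
    inferInstanceAs <| T2Space ((w : InfinitePlace K) → w.Completion)
  exact inferInstanceAs <| T2Space (InfiniteAdeleRing K × FiniteAdeleRing (𝓞 K) K)

/-- if `x ⬝ᵥ y ≠ 0` then `x ≠ 0` and `y ≠ 0`. [folklore] -/
private theorem ne_zero_of_dotProduct_ne_zero {K : Type*} [NonUnitalNonAssocSemiring K] {κ : Type*} [Fintype κ]
    {x y : κ → K} (h : x ⬝ᵥ y ≠ 0) : x ≠ 0 ∧ y ≠ 0 := by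
  constructor
  · rintro rfl; exact h (zero_dotProduct y)
  · rintro rfl; exact h (dotProduct_zero x)

variable (F E : Type) [Field F] [NumberField F] [Field E] [NumberField E] [Algebra F E] [Algebra.IsQuadraticExtension F E]
  (c : E ≃ₐ[F] E) {δ : E} (hcδ : c δ = -δ) (hδ : δ ≠ 0) {d : F} (hd : δ * δ = algebraMap F E d)
  (N : ℕ) {n : ℕ} (e : Fin N × Fin 1 ≃ Fin n)
  (TV : Matrix (Fin N) (Fin N) F) (hV : TV.IsSymm) (hVd : IsUnit TV.det)
  (TW : Matrix (Fin 1) (Fin 1) F) (hW : TW.IsSymm) (hWd : IsUnit TW.det)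
  [LocallyCompactSpace (UnitaryGroup.adelic F E c N (TV.map (algebraMap F E)))]
  [CompactSpace (UnitaryGroup.adelic F E c N (TV.map (algebraMap F E)) ⧸ (UnitaryGroup.toAdelic F E c N (TV.map (algebraMap F E))).range)]
  [MeasurableSpace (UnitaryGroup.adelic F E c N (TV.map (algebraMap F E)) ⧸ (UnitaryGroup.toAdelic F E c N (TV.map (algebraMap F E))).range)]
  [BorelSpace (UnitaryGroup.adelic F E c N (TV.map (algebraMap F E)) ⧸ (UnitaryGroup.toAdelic F E c N (TV.map (algebraMap F E))).range)]
  (ν : Measure (UnitaryGroup.adelic F E c N (TV.map (algebraMap F E)) ⧸ (UnitaryGroup.toAdelic F E c N (TV.map (algebraMap F E))).range))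
  [IsFiniteMeasure ν]
  [SMulInvariantMeasure (UnitaryGroup.adelic F E c N (TV.map (algebraMap F E)))
    (UnitaryGroup.adelic F E c N (TV.map (algebraMap F E)) ⧸ (UnitaryGroup.toAdelic F E c N (TV.map (algebraMap F E))).range) ν]
  [MeasurableSpace (adeleQuotient F)] [BorelSpace (adeleQuotient F)]
  [MeasurableSpace (AdeleRing (𝓞 F) F)] [BorelSpace (AdeleRing (𝓞 F) F)]
  (νX : Measure (Fin (n + n) → AdeleRing (𝓞 F) F)) [νX.IsAddHaarMeasure]
  (h : (Fin (n + n) → AdeleRing (𝓞 F) F) → AdeleRing (𝓞 F) F) (hh : Continuous h)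
  (v : HeightOneSpectrum (𝓞 F))
  [MeasurableSpace (v.adicCompletion F)] [BorelSpace (v.adicCompletion F)]
  (μK : Measure (v.adicCompletion F)) [μK.IsAddHaarMeasure]

include hδ μK in
/-- **THE SPLIT-PLACE FRAME AND THE TWO (T2a)-TRIPLES AT THE CM DATUM (the `βv fr he1 he2 H₁ H₂` binders of (T1)
`doubledThetaIntegral_eq_mul_eis_of_frame`, for every `b ≠ 0`, with `b' b := (b : F_v)`).**  At a finite place `v` of `F` with
`s² = d` in `F_v`: there are a homeomorphism `βv : F_v^{n+n} ≃ₜ F_v^n × F_v^n` and a frame `fr : X□(𝔸_F) ≃ₜ (F_v^n × F_v^n) × X□(𝔸_F)^{(v)}`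
with `(fr x).1 = βv (x_v)`, `(fr x).2 = (placeSplitting⁻¹ x).2`, `βv` carrying Haar to `cst • (Haar ⊗ Haar)`, such that for every `b ≠ 0`
the pushed theta-side fibre measure `fr_* μ̂_b` (of `Λ_θ,ℝ` along `h = hNorm`) and the pushed Eisenstein-side fibre measure `fr_* μ_b`
(of `E_X` along `h`) are finite on compact rectangles, invariant on Borel rectangles under `(x, y) ↦ (g x, g⁻ᵀ y)` (`g ∈ GL_n(F_v)`), and
carried by `S_b × Y` — the letters being A-p01's ★ `exists_splitPlaceLetters` (frame, isometries `T g = A_{h_g}`, `hfib`, `hTh`, `hTS`,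
`hTe`), ★ `measurePreserving_vDiagAct` (`hTμ`), and the two ★ generic split-place producers.
[cite: Weil1965, Chap. IV n° 46, p. 66; Chap. V n° 50, pp. 73–74] -/
theorem exists_frame_identityClose_triples
    (hhN : ∀ x, h x = hNorm F E c hcδ hδ N e TV hVd TW hWd x)
    (hB : ∀ Φ ∈ piSchwartzBruhat F (Fin (n + n)), Summable fun ξ : F => ‖adelicSiegelCoeff F (Fin (n + n)) νX h Φ ξ‖)
    {s : v.adicCompletion F} (hs : s * s = algebraMap F (v.adicCompletion F) d) :
    ∃ (βv : (Fin (n + n) → v.adicCompletion F) ≃ₜ ((Fin n → v.adicCompletion F) × (Fin n → v.adicCompletion F)))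
      (fr : (Fin (n + n) → AdeleRing (𝓞 F) F) ≃ₜ
        (((Fin n → v.adicCompletion F) × (Fin n → v.adicCompletion F)) × trivialAt F (Fin (n + n)) v)),
      (∀ x, (fr x).1 = βv (evalAt F (Fin (n + n)) v x)) ∧
      (∀ x, (fr x).2 = ((placeSplitting F (Fin (n + n)) v).symm x).2) ∧
      (∃ cst : ℝ≥0, 0 < cst ∧
        Measure.map βv (Measure.pi fun _ : Fin (n + n) => μK) =
          (cst : ℝ≥0∞) • ((Measure.pi fun _ : Fin n => μK).prod (Measure.pi fun _ : Fin n => μK))) ∧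
      (∀ b : F, b ≠ 0 →
        (∀ (L : Set ((Fin n → v.adicCompletion F) × (Fin n → v.adicCompletion F))) (B : Set (trivialAt F (Fin (n + n)) v)),
            IsCompact L → IsCompact B →
          ((fibreMeasure F (Fin (n + n)) (thetaOrbitFunctionalReal F E c hcδ hδ hd N e TV hV hVd TW hW hWd ν)
            (thetaOrbitFunctionalReal_nonneg F E c hcδ hδ hd N e TV hV hVd TW hW hWd ν) h b).map fr) (L ×ˢ B) < ⊤) ∧
        (∀ (g : GL (Fin n) (v.adicCompletion F)) (A : Set ((Fin n → v.adicCompletion F) × (Fin n → v.adicCompletion F)))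
            (B : Set (trivialAt F (Fin (n + n)) v)), MeasurableSet A → MeasurableSet B →
          ((fibreMeasure F (Fin (n + n)) (thetaOrbitFunctionalReal F E c hcδ hδ hd N e TV hV hVd TW hW hWd ν)
            (thetaOrbitFunctionalReal_nonneg F E c hcδ hδ hd N e TV hV hVd TW hW hWd ν) h b).map fr)
            (((fun z => (((g : Matrix (Fin n) (Fin n) (v.adicCompletion F)) *ᵥ z.1,
                ((g⁻¹ : GL (Fin n) (v.adicCompletion F)) : Matrix (Fin n) (Fin n) (v.adicCompletion F))ᵀ *ᵥ z.2) :
                  (Fin n → v.adicCompletion F) × (Fin n → v.adicCompletion F))) ⁻¹' A) ×ˢ B) =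
          ((fibreMeasure F (Fin (n + n)) (thetaOrbitFunctionalReal F E c hcδ hδ hd N e TV hV hVd TW hW hWd ν)
            (thetaOrbitFunctionalReal_nonneg F E c hcδ hδ hd N e TV hV hVd TW hW hWd ν) h b).map fr) (A ×ˢ B)) ∧
        ((fibreMeasure F (Fin (n + n)) (thetaOrbitFunctionalReal F E c hcδ hδ hd N e TV hV hVd TW hW hWd ν)
            (thetaOrbitFunctionalReal_nonneg F E c hcδ hδ hd N e TV hV hVd TW hW hWd ν) h b).map fr)
          ({z : (Fin n → v.adicCompletion F) × (Fin n → v.adicCompletion F) |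
              z.1 ⬝ᵥ z.2 = (b : v.adicCompletion F) ∧ z.1 ≠ 0 ∧ z.2 ≠ 0}ᶜ ×ˢ (univ : Set (trivialAt F (Fin (n + n)) v))) = 0) ∧
      (∀ b : F, b ≠ 0 →
        (∀ (L : Set ((Fin n → v.adicCompletion F) × (Fin n → v.adicCompletion F))) (B : Set (trivialAt F (Fin (n + n)) v)),
            IsCompact L → IsCompact B →
          ((adelicSiegelFibreMeasure F (Fin (n + n)) νX h hh hB b).map fr) (L ×ˢ B) < ⊤) ∧
        (∀ (g : GL (Fin n) (v.adicCompletion F)) (A : Set ((Fin n → v.adicCompletion F) × (Fin n → v.adicCompletion F)))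
            (B : Set (trivialAt F (Fin (n + n)) v)), MeasurableSet A → MeasurableSet B →
          ((adelicSiegelFibreMeasure F (Fin (n + n)) νX h hh hB b).map fr)
            (((fun z => (((g : Matrix (Fin n) (Fin n) (v.adicCompletion F)) *ᵥ z.1,
                ((g⁻¹ : GL (Fin n) (v.adicCompletion F)) : Matrix (Fin n) (Fin n) (v.adicCompletion F))ᵀ *ᵥ z.2) :
                  (Fin n → v.adicCompletion F) × (Fin n → v.adicCompletion F))) ⁻¹' A) ×ˢ B) =
          ((adelicSiegelFibreMeasure F (Fin (n + n)) νX h hh hB b).map fr) (A ×ˢ B)) ∧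
        ((adelicSiegelFibreMeasure F (Fin (n + n)) νX h hh hB b).map fr)
          ({z : (Fin n → v.adicCompletion F) × (Fin n → v.adicCompletion F) |
              z.1 ⬝ᵥ z.2 = (b : v.adicCompletion F) ∧ z.1 ≠ 0 ∧ z.2 ≠ 0}ᶜ ×ˢ (univ : Set (trivialAt F (Fin (n + n)) v))) = 0) := by
  -- the E-side norm letter IS `hNorm`
  obtain rfl : h = hNorm F E c hcδ hδ N e TV hVd TW hWd := funext hhN
  haveI : T2Space (AdeleRing (𝓞 F) F) := t2Space_adeleRing' F
  haveI : T2Space (trivialAt F (Fin (n + n)) v) := inferInstance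
  haveI := secondCountableTopology_adeleRing (K := F)
  haveI : BorelSpace (Fin (n + n) → AdeleRing (𝓞 F) F) := Pi.borelSpace
  haveI := AdelicVector.secondCountableTopology_trivialAt (K := F) (ι := Fin (n + n)) (v := v)
  haveI : BorelSpace (trivialAt F (Fin (n + n)) v) := Subtype.borelSpace _
  -- A-p01's letters
  obtain ⟨β, eH, T, heH, hHaar, hfib0, hT, hTh, hTS, hTe⟩ :=
    exists_splitPlaceLetters F E c hcδ hδ hd N e TV hV hVd TW hW hWd v hs μK
  choose sel hsel using hT
  haveI : ContinuousSMul (v.adicCompletion F) (v.adicCompletion F) := ⟨continuous_mul⟩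
  let βH : (Fin (n + n) → v.adicCompletion F) ≃ₜ ((Fin n → v.adicCompletion F) × (Fin n → v.adicCompletion F)) :=
    { toEquiv := β.toEquiv
      continuous_toFun := β.toLinearMap.continuous_on_pi
      continuous_invFun := continuous_linearEquiv_symm_prod β }
  -- `hfib` with the non-vanishing clauses, for `b ≠ 0`
  have hfib : ∀ b : F, b ≠ 0 → ∀ x, hNorm F E c hcδ hδ N e TV hVd TW hWd x = algebraMap F (AdeleRing (𝓞 F) F) b →
      (eH x).1.1 ⬝ᵥ (eH x).1.2 = (b : v.adicCompletion F) ∧ (eH x).1.1 ≠ 0 ∧ (eH x).1.2 ≠ 0 := by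
    intro b hb x hxb
    have h1 := hfib0 x b hxb
    have hb' : ((b : v.adicCompletion F)) ≠ 0 := by
      rw [ne_eq, ← map_zero (algebraMap F (v.adicCompletion F))]
      exact fun h0 => hb ((algebraMap F (v.adicCompletion F)).injective h0)
    exact ⟨h1, ne_zero_of_dotProduct_ne_zero (h1 ▸ hb')⟩
  -- `hTe` in selector form (theta side) and `hTμ` (Eisenstein side)
  have hTe' : ∀ g x, eH (vDiagAct F E c hcδ hδ hd N e TV hV hVd TW hW hWd (sel g) x) =
      ((((g : Matrix (Fin n) (Fin n) (v.adicCompletion F)) *ᵥ (eH x).1.1,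
          ((g⁻¹ : GL (Fin n) (v.adicCompletion F)) : Matrix (Fin n) (Fin n) (v.adicCompletion F))ᵀ *ᵥ (eH x).1.2) :
            (Fin n → v.adicCompletion F) × (Fin n → v.adicCompletion F)), (eH x).2) := fun g x => by
    rw [← hTe g x, hsel g]
  have hTμ : ∀ g, MeasurePreserving (T g) νX νX := fun g => by
    have h1 := measurePreserving_vDiagAct F E c hcδ hδ hd N e TV hV hVd TW hW hWd νX (sel g)
    have h2 : (⇑(T g) : (Fin (n + n) → AdeleRing (𝓞 F) F) → (Fin (n + n) → AdeleRing (𝓞 F) F)) =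
        ⇑(vDiagAct F E c hcδ hδ hd N e TV hV hVd TW hW hWd (sel g)) := hsel g
    rw [h2]; exact h1
  refine ⟨βH, eH, fun x => by rw [heH]; rfl, fun x => by rw [heH], hHaar, fun b hb => ?_, fun b hb => ?_⟩
  · -- `H₁ b`: the theta side (★ A-p08 (g17))
    exact map_fibreMeasure_thetaOrbitFunctionalReal_identityClose_hypotheses F E c hcδ hδ hd N e TV hV hVd TW hW hWd ν eH b
      (b : v.adicCompletion F) (hfib b hb) sel hTe'
  · -- `H₂ b`: the Eisenstein side (★ A-p08 (g17)), `hTμ` from ★ A-p01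
    exact map_adelicSiegelFibreMeasure_identityClose_hypotheses F (Fin (n + n)) νX _ hh hB eH b (b : v.adicCompletion F)
      (hfib b hb) T hTμ hTh hTS hTe

end Summit.HodgeConjecture.HodgeConjecture.Cruxes.H413.E2SWIdentityCloseTriplesCM

end
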